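import Summits.ResolutionOfSingularities.ResolutionOfSingularities.Theorems.ValuativeLuAlphaPTorsorAdaptedDefs
import Summits.ResolutionOfSingularities.ResolutionOfSingularities.Theorems.ValuativeLuAlphaPTorsorValueStepHelpers
import HarnessLib

/-!
# Adapted value step, I: values-only lemmas (type-2 transforms of flag-adapted families)

Crux `Valuative.LuAlphaPTorsor` (stmt-ResolutionOfSingularities-0641), line `pfaff-line-log-final-forms`,
registered stub `stub_adaptedValueStep` (F6v, wave 2: the ADAPTED value step of the purely
inseparable tower, any rank) — helper file 1/8.

Everything here lives in an abstract linearly ordered commutative group with zero `Γ₀`: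
Laurent-monomial algebra (`τ^(a+b)`, `τ^(a-b)`, finite sums of exponents), the usable form of
clause (C2a) of `AdaptedValues` (a parameter is smaller than every Laurent monomial of the
strictly lower levels), and the stability of the clauses (C2a), (C2b), (C4) and of
`LevelArchimedean`, of `ℤ`-independence and of the values `< 1` under a TYPE-2 TRANSFORM
`η j := τ j / τ^(D j)`, `D j` supported on the levels `< lv j`; finally lower monomials of the
old family are lower monomials of the new one (`adValue_t2_lower_repr`). [folklore]
-/

noncomputable section

-- `Summit.<S>.<S>.…` duplicates the summit name by design (D-0017, single-problem summit).
set_option linter.dupNamespace false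

open IsLocalRing

namespace Summit.ResolutionOfSingularities.ResolutionOfSingularities.Theorems.PfaffLine

open Literature.AlgebraicGeometry.Resolution

section MonomialAlgebra

variable {Γ₀ : Type} [CommGroupWithZero Γ₀] {n : ℕ} (τ : Fin n → Γ₀)

/-- Laurent monomials turn finite sums of exponent vectors into products. -/
theorem adValue_prod_zpow_finsum (hτ0 : ∀ i, τ i ≠ 0) {ι : Type} (s : Finset ι)
    (a : ι → Fin n → ℤ) :
    ∏ i, τ i ^ (∑ j ∈ s, a j) i = ∏ j ∈ s, ∏ i, τ i ^ (a j i) := by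
  classical
  induction s using Finset.induction_on with
  | empty => simp
  | insert j s hj ih =>
    rw [Finset.sum_insert hj, prod_zpow_add_eq τ hτ0, ih, Finset.prod_insert hj]

/-- Laurent monomials: `τ^(a - b) = τ^a / τ^b`. -/
theorem adValue_prod_zpow_sub (hτ0 : ∀ i, τ i ≠ 0) (a b : Fin n → ℤ) :
    ∏ i, τ i ^ (a - b) i = (∏ i, τ i ^ (a i)) * (∏ i, τ i ^ (b i))⁻¹ := by
  rw [sub_eq_add_neg, prod_zpow_add_eq τ hτ0, prod_zpow_neg_eq]

/-- A Laurent monomial in non-zero values is non-zero. -/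
theorem adValue_prod_zpow_ne_zero (hτ0 : ∀ i, τ i ≠ 0) (a : Fin n → ℤ) :
    (∏ i, τ i ^ (a i)) ≠ 0 :=
  Finset.prod_ne_zero_iff.mpr fun i _ => zpow_ne_zero _ (hτ0 i)

end MonomialAlgebra

section Values

variable {Γ₀ : Type} [LinearOrderedCommGroupWithZero Γ₀] {n : ℕ} (τ : Fin n → Γ₀)

/-- A Laurent monomial in non-zero values is positive. -/
theorem adValue_prod_zpow_pos (hτ0 : ∀ i, τ i ≠ 0) (a : Fin n → ℤ) :
    0 < ∏ i, τ i ^ (a i) :=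
  zero_lt_iff.mpr (adValue_prod_zpow_ne_zero τ hτ0 a)

/-- A monomial with exponents in `ℕ` in values `≤ 1` is `≤` each of its factors `τ j`
appearing with a positive exponent. -/
theorem adValue_prod_pow_le_single (h1 : ∀ j, τ j ≤ 1) (c : Fin n → ℕ) {j : Fin n}
    (hj : c j ≠ 0) : (∏ i, τ i ^ (c i)) ≤ τ j := by
  classical
  rw [← Finset.mul_prod_erase Finset.univ _ (Finset.mem_univ j)]
  calc τ j ^ c j * ∏ i ∈ Finset.univ.erase j, τ i ^ c i ≤ τ j ^ c j :=
        mul_le_of_le_one_right' (Finset.prod_le_one' fun i _ => pow_le_one' (h1 i) _)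
    _ ≤ τ j ^ 1 := pow_le_pow_right_of_le_one' (h1 j) (Nat.one_le_iff_ne_zero.mpr hj)
    _ = τ j := pow_one _

variable (lv : Fin n → ℕ)

/-- **(C2a), usable form.** If every `τ j < 1` and (C2a) holds, then `τ i` is smaller than every
Laurent monomial supported on the levels `< lv i`. -/
theorem adValue_lt_lower
    (hC2a : ∀ i i', lv i < lv i' → ∀ m : Fin n → ℤ, (∀ j, lv i < lv j → m j = 0) →
      τ i' < ∏ j, τ j ^ (m j))
    (h1 : ∀ j, τ j < 1) (i : Fin n) (m : Fin n → ℤ) (hm : ∀ j, lv i ≤ lv j → m j = 0) :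
    τ i < ∏ j, τ j ^ (m j) := by
  classical
  by_cases hm0 : ∀ j, m j = 0
  · have : (∏ j, τ j ^ (m j)) = 1 := Finset.prod_eq_one fun j _ => by rw [hm0 j, zpow_zero]
    rw [this]
    exact h1 i
  · push Not at hm0
    obtain ⟨j₀, hj₀, hmax⟩ := Finset.exists_max_image (Finset.univ.filter fun j => m j ≠ 0) lv
      (by obtain ⟨j, hj⟩ := hm0; exact ⟨j, Finset.mem_filter.mpr ⟨Finset.mem_univ _, hj⟩⟩)
    have hj₀' : m j₀ ≠ 0 := (Finset.mem_filter.mp hj₀).2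
    have hlt : lv j₀ < lv i := by
      by_contra h
      exact hj₀' (hm j₀ (not_lt.mp h))
    refine hC2a j₀ i hlt m fun j hj => ?_
    by_contra hmj
    exact absurd (hmax j (Finset.mem_filter.mpr ⟨Finset.mem_univ _, hmj⟩)) (not_le.mpr hj)

/-- A parameter of level `≥ ℓ` is smaller than every Laurent monomial supported on levels `< ℓ`. -/
theorem adValue_high_lt_low
    (hC2a : ∀ i i', lv i < lv i' → ∀ m : Fin n → ℤ, (∀ j, lv i < lv j → m j = 0) →
      τ i' < ∏ j, τ j ^ (m j))
    (h1 : ∀ j, τ j < 1) (ℓ : ℕ) (h : Fin n) (hh : ℓ ≤ lv h) (m : Fin n → ℤ)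
    (hm : ∀ j, ℓ ≤ lv j → m j = 0) : τ h < ∏ j, τ j ^ (m j) :=
  adValue_lt_lower τ lv hC2a h1 h m fun j hj => hm j (hh.trans hj)

/-! ### Type-2 transforms of an adapted family of values

`η j := τ j / τ^{D j}` with `D j` supported on the levels `< lv j`. -/

variable (D : Fin n → Fin n → ℕ)

/-- The exponent transform of a type-2 change of parameters. -/
theorem adValue_t2_prod (hτ0 : ∀ i, τ i ≠ 0) (m : Fin n → ℤ) :
    (∏ j, (τ j * (∏ i, τ i ^ (D j i))⁻¹) ^ (m j)) =
      ∏ i, τ i ^ ((m - ∑ j, m j • fun i => (D j i : ℤ)) i) := by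
  rw [adValue_prod_zpow_sub τ hτ0, adValue_prod_zpow_finsum τ hτ0, ← Finset.prod_inv_distrib,
    ← Finset.prod_mul_distrib]
  refine Finset.prod_congr rfl fun j _ => ?_
  rw [mul_zpow, inv_zpow, prod_zpow_smul_eq]
  simp only [zpow_natCast]

/-- Support of the transformed exponent: if `D j` lives on levels `< lv j` and `m` vanishes on
the levels `≥ b`, so does the transformed exponent. -/
theorem adValue_t2_supp_le (hD : ∀ j i, lv j ≤ lv i → D j i = 0) (b : ℕ) (m : Fin n → ℤ)
    (hm : ∀ j, b ≤ lv j → m j = 0) (i : Fin n) (hi : b ≤ lv i) :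
    (m - ∑ j, m j • fun i => (D j i : ℤ)) i = 0 := by
  simp only [Pi.sub_apply, Finset.sum_apply, Pi.smul_apply, smul_eq_mul, hm i hi, zero_sub,
    neg_eq_zero]
  refine Finset.sum_eq_zero fun j _ => ?_
  by_cases hj : b ≤ lv j
  · rw [hm j hj, zero_mul]
  · rw [hD j i (le_of_lt ((not_le.mp hj).trans_le hi)), Nat.cast_zero, mul_zero]

/-- Same with strict levels: if `m` vanishes on the levels `> b`, so does the transform. -/
theorem adValue_t2_supp_lt (hD : ∀ j i, lv j ≤ lv i → D j i = 0) (b : ℕ) (m : Fin n → ℤ)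
    (hm : ∀ j, b < lv j → m j = 0) (i : Fin n) (hi : b < lv i) :
    (m - ∑ j, m j • fun i => (D j i : ℤ)) i = 0 :=
  adValue_t2_supp_le lv D hD (b + 1) m (fun j hj => hm j hj) i hi

/-- The correction `∑ m j • D j` of an exponent supported on levels `≤ b` lives on levels `< b`. -/
theorem adValue_t2_corr_supp (hD : ∀ j i, lv j ≤ lv i → D j i = 0) (b : ℕ) (m : Fin n → ℤ)
    (hm : ∀ j, b < lv j → m j = 0) (i : Fin n) (hi : b ≤ lv i) :
    (∑ j, m j • fun i => (D j i : ℤ)) i = 0 := by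
  simp only [Finset.sum_apply, Pi.smul_apply, smul_eq_mul]
  refine Finset.sum_eq_zero fun j _ => ?_
  by_cases hj : b < lv j
  · rw [hm j hj, zero_mul]
  · rw [hD j i ((not_lt.mp hj).trans hi), Nat.cast_zero, mul_zero]

/-- The new parameters of a type-2 transform are `< 1`. -/
theorem adValue_t2_lt_one (hτ0 : ∀ i, τ i ≠ 0)
    (hC2a : ∀ i i', lv i < lv i' → ∀ m : Fin n → ℤ, (∀ j, lv i < lv j → m j = 0) →
      τ i' < ∏ j, τ j ^ (m j))
    (h1 : ∀ j, τ j < 1) (hD : ∀ j i, lv j ≤ lv i → D j i = 0) (j : Fin n) :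
    τ j * (∏ i, τ i ^ (D j i))⁻¹ < 1 := by
  have hpos : 0 < ∏ i, τ i ^ (D j i) := Finset.prod_pos fun i _ => pow_pos (zero_lt_iff.mpr (hτ0 i)) _
  rw [mul_inv_lt_iff₀ hpos, one_mul]
  have := adValue_lt_lower τ lv hC2a h1 j (fun i => (D j i : ℤ)) fun i hi => by
    rw [hD j i hi, Nat.cast_zero]
  simpa only [zpow_natCast] using this

/-- `ℤ`-independence survives a type-2 transform. -/
theorem adValue_t2_indep (hτ0 : ∀ i, τ i ≠ 0) (hD : ∀ j i, lv j ≤ lv i → D j i = 0)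
    (hind : ∀ m : Fin n → ℤ, (∏ i, τ i ^ (m i)) = 1 → m = 0) (m : Fin n → ℤ)
    (hm : (∏ j, (τ j * (∏ i, τ i ^ (D j i))⁻¹) ^ (m j)) = 1) : m = 0 := by
  classical
  rw [adValue_t2_prod τ D hτ0] at hm
  have h0 := hind _ hm
  by_contra hne
  have hex : ∃ j, m j ≠ 0 := by
    by_contra h
    push Not at h
    exact hne (funext h)
  obtain ⟨j₀, hj₀, hmax⟩ := Finset.exists_max_image (Finset.univ.filter fun j => m j ≠ 0) lv
    (by obtain ⟨j, hj⟩ := hex; exact ⟨j, Finset.mem_filter.mpr ⟨Finset.mem_univ _, hj⟩⟩)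
  have hj₀' : m j₀ ≠ 0 := (Finset.mem_filter.mp hj₀).2
  have hcorr : (∑ j, m j • fun i => (D j i : ℤ)) j₀ = 0 :=
    adValue_t2_corr_supp lv D hD (lv j₀) m (fun j hj => by
      by_contra hmj
      exact absurd (hmax j (Finset.mem_filter.mpr ⟨Finset.mem_univ _, hmj⟩)) (not_le.mpr hj))
      j₀ le_rfl
  have h1 := congrFun h0 j₀
  rw [Pi.sub_apply, hcorr, sub_zero] at h1
  exact hj₀' h1

/-- (C2a) survives a type-2 transform. -/
theorem adValue_t2_C2a (hτ0 : ∀ i, τ i ≠ 0)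
    (hC2a : ∀ i i', lv i < lv i' → ∀ m : Fin n → ℤ, (∀ j, lv i < lv j → m j = 0) →
      τ i' < ∏ j, τ j ^ (m j))
    (h1 : ∀ j, τ j < 1) (hD : ∀ j i, lv j ≤ lv i → D j i = 0) :
    ∀ i i', lv i < lv i' → ∀ m : Fin n → ℤ, (∀ j, lv i < lv j → m j = 0) →
      τ i' * (∏ i, τ i ^ (D i' i))⁻¹ < ∏ j, (τ j * (∏ i, τ i ^ (D j i))⁻¹) ^ (m j) := by
  intro i i' hii' m hm
  have hpos : 0 < ∏ i, τ i ^ (D i' i) := Finset.prod_pos fun i _ => pow_pos (zero_lt_iff.mpr (hτ0 i)) _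
  rw [adValue_t2_prod τ D hτ0, mul_inv_lt_iff₀ hpos]
  have hD' : (∏ i, τ i ^ (D i' i)) = ∏ i, τ i ^ ((fun i => (D i' i : ℤ)) i) :=
    Finset.prod_congr rfl fun i _ => (zpow_natCast _ _).symm
  rw [hD', ← prod_zpow_add_eq τ hτ0]
  refine adValue_lt_lower τ lv hC2a h1 i' _ fun j hj => ?_
  rw [Pi.add_apply, adValue_t2_supp_lt lv D hD (lv i) m hm j (hii'.trans_le hj), zero_add,
    hD i' j hj, Nat.cast_zero]

/-- The comparability of the parameters of one level survives a type-2 transform. -/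
theorem adValue_t2_C2b (hτ0 : ∀ i, τ i ≠ 0)
    (hC2a : ∀ i i', lv i < lv i' → ∀ m : Fin n → ℤ, (∀ j, lv i < lv j → m j = 0) →
      τ i' < ∏ j, τ j ^ (m j))
    (hC2b : ∀ i i', lv i = lv i' → ∃ N : ℕ, τ i ^ N < τ i')
    (h1 : ∀ j, τ j < 1) (hD : ∀ j i, lv j ≤ lv i → D j i = 0) :
    ∀ i i', lv i = lv i' → ∃ N : ℕ,
      (τ i * (∏ j, τ j ^ (D i j))⁻¹) ^ N < τ i' * (∏ j, τ j ^ (D i' j))⁻¹ := by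
  intro i i' hii'
  obtain ⟨N, hN⟩ := hC2b i i' hii'
  refine ⟨N + 1, ?_⟩
  have hpos : ∀ j, 0 < ∏ l, τ l ^ (D j l) := fun j =>
    Finset.prod_pos fun l _ => pow_pos (zero_lt_iff.mpr (hτ0 l)) _
  -- the correcting monomial `τ^{(N+1) D i - D i'}` is supported below `lv i`
  let c : Fin n → ℤ := fun l => ((N + 1 : ℕ) : ℤ) * (D i l : ℤ) - (D i' l : ℤ)
  have hc : τ i < ∏ l, τ l ^ (c l) := adValue_lt_lower τ lv hC2a h1 i c fun l hl => by
    simp only [c, hD i l hl, hD i' l (hii' ▸ hl), Nat.cast_zero, mul_zero, sub_zero]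
  have hceq : (∏ l, τ l ^ (c l)) = (∏ l, τ l ^ (D i l)) ^ (N + 1) * (∏ l, τ l ^ (D i' l))⁻¹ := by
    rw [← Finset.prod_pow, ← Finset.prod_inv_distrib, ← Finset.prod_mul_distrib]
    refine Finset.prod_congr rfl fun l _ => ?_
    rw [zpow_sub₀ (hτ0 l), zpow_mul, zpow_natCast, zpow_natCast, zpow_natCast, div_eq_mul_inv,
      pow_right_comm]
  rw [mul_pow, inv_pow, mul_inv_lt_iff₀ (pow_pos (hpos i) _)]
  calc τ i ^ (N + 1) = τ i ^ N * τ i := pow_succ _ _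
    _ < τ i' * ∏ l, τ l ^ (c l) := mul_lt_mul'' hN hc zero_le zero_le
    _ = τ i' * (∏ j, τ j ^ (D i' j))⁻¹ * (∏ j, τ j ^ (D i j)) ^ (N + 1) := by
        rw [hceq]; ac_rfl

/-- (C4) survives a type-2 transform. -/
theorem adValue_t2_C4 (hτ0 : ∀ i, τ i ≠ 0) (hD : ∀ j i, lv j ≤ lv i → D j i = 0)
    (hC4 : ∀ (ℓ : ℕ) (μ : Fin n → ℤ), (∀ j, lv j ≠ ℓ → μ j = 0) → μ ≠ 0 →
      (∀ m : Fin n → ℤ, (∀ j, ℓ ≤ lv j → m j = 0) → (∏ j, τ j ^ (μ j)) < ∏ j, τ j ^ (m j)) ∨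
      (∀ m : Fin n → ℤ, (∀ j, ℓ ≤ lv j → m j = 0) → (∏ j, τ j ^ (m j)) < ∏ j, τ j ^ (μ j))) :
    ∀ (ℓ : ℕ) (μ : Fin n → ℤ), (∀ j, lv j ≠ ℓ → μ j = 0) → μ ≠ 0 →
      (∀ m : Fin n → ℤ, (∀ j, ℓ ≤ lv j → m j = 0) →
        (∏ j, (τ j * (∏ i, τ i ^ (D j i))⁻¹) ^ (μ j)) <
          ∏ j, (τ j * (∏ i, τ i ^ (D j i))⁻¹) ^ (m j)) ∨
      (∀ m : Fin n → ℤ, (∀ j, ℓ ≤ lv j → m j = 0) →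
        (∏ j, (τ j * (∏ i, τ i ^ (D j i))⁻¹) ^ (m j)) <
          ∏ j, (τ j * (∏ i, τ i ^ (D j i))⁻¹) ^ (μ j)) := by
  intro ℓ μ hμ hμ0
  -- `η^μ = τ^μ / τ^d` with `d` supported on levels `< ℓ`
  set d : Fin n → ℤ := ∑ j, μ j • fun i => (D j i : ℤ) with hd
  have hdsupp : ∀ i, ℓ ≤ lv i → d i = 0 := fun i hi =>
    adValue_t2_corr_supp lv D hD ℓ μ (fun j hj => hμ j (ne_of_gt hj)) i hi
  have hημ : (∏ j, (τ j * (∏ i, τ i ^ (D j i))⁻¹) ^ (μ j)) =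
      (∏ j, τ j ^ (μ j)) * (∏ j, τ j ^ (d j))⁻¹ := by
    rw [adValue_t2_prod τ D hτ0, adValue_prod_zpow_sub τ hτ0]
  have hηm : ∀ m : Fin n → ℤ, (∀ j, ℓ ≤ lv j → m j = 0) →
      ∃ m' : Fin n → ℤ, (∀ j, ℓ ≤ lv j → m' j = 0) ∧
        (∏ j, (τ j * (∏ i, τ i ^ (D j i))⁻¹) ^ (m j)) = ∏ j, τ j ^ (m' j) := fun m hm =>
    ⟨_, adValue_t2_supp_le lv D hD ℓ m hm, adValue_t2_prod τ D hτ0 m⟩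
  have hpos := adValue_prod_zpow_pos τ hτ0 d
  rcases hC4 ℓ μ hμ hμ0 with hA | hB
  · left
    intro m hm
    obtain ⟨m', hm', hm'eq⟩ := hηm m hm
    rw [hημ, hm'eq, mul_inv_lt_iff₀ hpos, ← prod_zpow_add_eq τ hτ0]
    exact hA _ fun j hj => by rw [Pi.add_apply, hm' j hj, hdsupp j hj, add_zero]
  · right
    intro m hm
    obtain ⟨m', hm', hm'eq⟩ := hηm m hm
    rw [hημ, hm'eq, lt_mul_inv_iff₀ hpos, ← prod_zpow_add_eq τ hτ0]
    exact hB _ fun j hj => by rw [Pi.add_apply, hm' j hj, hdsupp j hj, add_zero]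

/-- `LevelArchimedean` survives a type-2 transform (needs (C4) of the old family to transfer
the hypothesis). -/
theorem adValue_t2_levelArch (hτ0 : ∀ i, τ i ≠ 0) (hD : ∀ j i, lv j ≤ lv i → D j i = 0)
    (hC4 : ∀ (ℓ : ℕ) (μ : Fin n → ℤ), (∀ j, lv j ≠ ℓ → μ j = 0) → μ ≠ 0 →
      (∀ m : Fin n → ℤ, (∀ j, ℓ ≤ lv j → m j = 0) → (∏ j, τ j ^ (μ j)) < ∏ j, τ j ^ (m j)) ∨
      (∀ m : Fin n → ℤ, (∀ j, ℓ ≤ lv j → m j = 0) → (∏ j, τ j ^ (m j)) < ∏ j, τ j ^ (μ j)))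
    (hLA : LevelArchimedean τ lv) :
    LevelArchimedean (fun j => τ j * (∏ i, τ i ^ (D j i))⁻¹) lv := by
  intro ℓ μ μ' hμ hμ' hsmall
  set d : Fin n → ℤ := ∑ j, μ j • fun i => (D j i : ℤ) with hd
  set d' : Fin n → ℤ := ∑ j, μ' j • fun i => (D j i : ℤ) with hd'
  have hdsupp : ∀ i, ℓ ≤ lv i → d i = 0 := fun i hi =>
    adValue_t2_corr_supp lv D hD ℓ μ (fun j hj => hμ j (ne_of_gt hj)) i hi
  have hd'supp : ∀ i, ℓ ≤ lv i → d' i = 0 := fun i hi =>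
    adValue_t2_corr_supp lv D hD ℓ μ' (fun j hj => hμ' j (ne_of_gt hj)) i hi
  have hημ : (∏ j, (τ j * (∏ i, τ i ^ (D j i))⁻¹) ^ (μ j)) =
      (∏ j, τ j ^ (μ j)) * (∏ j, τ j ^ (d j))⁻¹ := by
    rw [adValue_t2_prod τ D hτ0, adValue_prod_zpow_sub τ hτ0]
  have hημ' : (∏ j, (τ j * (∏ i, τ i ^ (D j i))⁻¹) ^ (μ' j)) =
      (∏ j, τ j ^ (μ' j)) * (∏ j, τ j ^ (d' j))⁻¹ := by
    rw [adValue_t2_prod τ D hτ0, adValue_prod_zpow_sub τ hτ0]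
  have hposd := adValue_prod_zpow_pos τ hτ0 d
  have hposd' := adValue_prod_zpow_pos τ hτ0 d'
  -- `μ ≠ 0`
  have hμ0 : μ ≠ 0 := by
    rintro rfl
    have h := hsmall 0 fun _ _ => rfl
    simp at h
  -- the old monomial `τ^μ` is below all lower monomials (case (B) of (C4) is impossible)
  have hA : ∀ m : Fin n → ℤ, (∀ j, ℓ ≤ lv j → m j = 0) →
      (∏ j, τ j ^ (μ j)) < ∏ j, τ j ^ (m j) := by
    rcases hC4 ℓ μ hμ hμ0 with hA | hB
    · exact hA
    · exfalso
      have h := hsmall 0 fun _ _ => rfl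
      rw [hημ] at h
      simp only [Pi.zero_apply, zpow_zero, Finset.prod_const_one, mul_inv_lt_iff₀ hposd,
        one_mul] at h
      exact lt_asymm h (hB d hdsupp)
  obtain ⟨N, hN⟩ := hLA ℓ μ μ' hμ hμ' hA
  refine ⟨N + 1, ?_⟩
  -- the correcting monomial
  let c : Fin n → ℤ := ((N + 1 : ℕ) : ℤ) • d - d'
  have hc : (∏ j, τ j ^ (μ j)) < ∏ l, τ l ^ (c l) := hA c fun l hl => by
    simp only [c, Pi.sub_apply, Pi.smul_apply, smul_eq_mul, hdsupp l hl, hd'supp l hl,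
      mul_zero, sub_zero]
  have hceq : (∏ l, τ l ^ (c l)) = (∏ l, τ l ^ (d l)) ^ (N + 1) * (∏ l, τ l ^ (d' l))⁻¹ := by
    change (∏ l, τ l ^ ((((N + 1 : ℕ) : ℤ) • d - d') l)) = _
    rw [adValue_prod_zpow_sub τ hτ0, prod_zpow_smul_eq, zpow_natCast]
  rw [hημ, hημ', mul_pow, inv_pow, mul_inv_lt_iff₀ (pow_pos hposd _)]
  calc (∏ j, τ j ^ (μ j)) ^ (N + 1) = (∏ j, τ j ^ (μ j)) ^ N * ∏ j, τ j ^ (μ j) := pow_succ _ _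
    _ < (∏ j, τ j ^ (μ' j)) * ∏ l, τ l ^ (c l) := mul_lt_mul'' hN hc zero_le zero_le
    _ = (∏ j, τ j ^ (μ' j)) * (∏ j, τ j ^ (d' j))⁻¹ * (∏ j, τ j ^ (d j)) ^ (N + 1) := by
        rw [hceq]; ac_rfl

/-- **Lower monomials of the old parameters are lower monomials of the new ones**: every
`τ^m` with `m` supported on the levels `< b` is `η^{m'}` with `m'` supported on the levels
`< b`. -/
theorem adValue_t2_lower_repr (hτ0 : ∀ i, τ i ≠ 0) (hD : ∀ j i, lv j ≤ lv i → D j i = 0) :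
    ∀ (b : ℕ) (m : Fin n → ℤ), (∀ j, b ≤ lv j → m j = 0) →
      ∃ m' : Fin n → ℤ, (∀ j, b ≤ lv j → m' j = 0) ∧
        (∏ j, τ j ^ (m j)) = ∏ j, (τ j * (∏ i, τ i ^ (D j i))⁻¹) ^ (m' j) := by
  intro b
  induction b with
  | zero =>
    intro m hm
    refine ⟨0, fun _ _ => rfl, ?_⟩
    have : m = 0 := funext fun j => hm j (Nat.zero_le _)
    simp [this]
  | succ b ih =>
    intro m hm
    -- `η^m = τ^m / τ^d` with `d` supported on levels `< b`
    set d : Fin n → ℤ := ∑ j, m j • fun i => (D j i : ℤ) with hd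
    have hdsupp : ∀ i, b ≤ lv i → d i = 0 := fun i hi =>
      adValue_t2_corr_supp lv D hD b m (fun j hj => hm j hj) i hi
    obtain ⟨m'', hm'', hm''eq⟩ := ih d hdsupp
    refine ⟨m + m'', fun j hj => ?_, ?_⟩
    · rw [Pi.add_apply, hm j hj, hm'' j ((Nat.le_succ b).trans hj), add_zero]
    · have hposd := adValue_prod_zpow_pos τ hτ0 d
      have hη0 : ∀ j, τ j * (∏ i, τ i ^ (D j i))⁻¹ ≠ 0 := fun j =>
        mul_ne_zero (hτ0 j) (inv_ne_zero (Finset.prod_ne_zero_iff.mpr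
          fun i _ => pow_ne_zero _ (hτ0 i)))
      rw [prod_zpow_add_eq _ hη0, ← hm''eq, adValue_t2_prod τ D hτ0, adValue_prod_zpow_sub τ hτ0,
        inv_mul_cancel_right₀ hposd.ne']

end Values

/-- Registered anchor of this helper file: a Laurent monomial in non-zero values is non-zero. -/
theorem adValue_anchor_values : ∀ (Γ₀ : Type) [LinearOrderedCommGroupWithZero Γ₀] (n : ℕ) (τ : Fin n → Γ₀), (∀ i, τ i ≠ 0) → ∀ a : Fin n → ℤ, (∏ i, τ i ^ (a i)) ≠ 0 := by
  intro Γ₀ _ n τ hτ0 a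
  exact adValue_prod_zpow_ne_zero τ hτ0 a

end Summit.ResolutionOfSingularities.ResolutionOfSingularities.Theorems.PfaffLine

end
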